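import Literature.Computability.AlgebraicComplexity.RectangularExponentInformationBound
import Mathlib.Order.LiminfLimsup
import Mathlib.Topology.Order.Basic
import HarnessLib

/-!
# Lotti–Romani 1983, Prop. 4.1: `inf_{x→∞} [f(x) − x] = 1` for `f(x) = B(1, x, 1)`

Topic `Literature/Computability/AlgebraicComplexity`. G. Lotti, F. Romani, *On the asymptotic complexity
of rectangular matrix multiplication*, TCS 23 (1983), read from the held text
(`paper:doi-10-1016-0304-3975-83-90054-3`):

* §2 (p. 174): «Let `f(x) = B(x, 1, 1)`, `f(x)` is a continuous and convex function and it is easy to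
  prove the following bounds on `f(x)`: `f(x) ≥ max(2, x + 1)`, `f(x) ≤ f(x + d) ≤ f(x) + d` for any
  `d ≥ 0`. … `f(x) = B(x, 1, 1) = B(1, x, 1) = B(1, 1, x)`.»
* §4 (p. 180–181): «… `q = 1` would imply that `f(x)` is arbitrarily close to the lower bound `x + 1` for
  sufficiently large `x`. This result, stated in [5], is proved in the following.
  **Proposition 4.1.** `inf_{x→∞} [f(x) − x] = 1`.» ([5] = Coppersmith, SIAM J. Comput. 11 (1982);
  the proof runs Example 3.2 — Schönhage's decomposition `⟨k,1,n⟩ ⊕ ⟨1,(k−1)(n−1),1⟩`, border rank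
  `≤ kn + 1` — through the paper's Prop. 3.3 and exhibits `x_n = (n−2)(1+O(1/ln n))`, `y_n ≥ f(x_n)` with
  `y_n − x_n = 1 + O(1/ln n)`.)

The paper works over `ℂ` (§1, p. 171: «entries are variables on the field ℂ») and `B` is the bilinear
(rank) exponent, i.e. the tree's `omegaRect ℂ` (`RectangularExponent.lean`; rendering note of
`RectangularExponentSubadditivity.lean`).

## Contents

* `omegaRect_one_mid_one_sub_antitone` — §2's `f(x + d) ≤ f(x) + d`, i.e. **`x ↦ ω(1,x,1) − x` is
  non-increasing** (PROVED, every field, from the tree's subadditivity `omegaRect_add_le_add_pos`), and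
  `one_le_omegaRect_one_mid_one_sub` — §2's `f(x) ≥ x + 1` (the tree's
  `max_two_add_one_le_omegaRect_one_mid_one`).
* `LottiRomani1983_prop41` — **Prop. 4.1 as printed, a named fact** (`def … : Prop`, not proved here):
  `liminf_{x→∞} (ω_ℂ(1,x,1) − x) = 1` (Mathlib `Filter.liminf … atTop`). Its proof needs the rectangular
  asymptotic sum inequality for sums of DIFFERENT formats (the paper's Prop. 3.3), which the tree does not
  have (it has Schönhage's example `algBorderRank_schoenhageExample` and the square `τ`-theorem only).
* PROVED consequences, the forms downstream wants: `LottiRomani1983_prop41.frequently_le`,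
  **`LottiRomani1983_prop41.eventually_le : ∀ ε > 0, ∃ k₀, ∀ k ≥ k₀, ω_ℂ(1,k,1) ≤ k + 1 + ε`**,
  `LottiRomani1983_prop41.tendsto` (`ω_ℂ(1,x,1) − x → 1`), and the equivalence
  `LottiRomani1983_prop41_iff_eventually_le` showing that, given §2, the printed statement IS the
  eventual bound (so nothing stronger than the source is vendored).

## References

* [LottiRomani1983] G. Lotti, F. Romani, TCS 23 (1983) 171–185 — §2 (p. 174), Prop. 4.1 (pp. 180–181).
* [Coppersmith1982] D. Coppersmith, *Rapid multiplication of rectangular matrices*, SIAM J. Comput. 11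
  (1982) 467–471 — p. 471, where Prop. 4.1 is stated (Lotti–Romani's [5]; held text
  `paper:doi-10-1137-0211037`, p0005).
-/

noncomputable section

open Filter Topology

namespace Literature.Computability.AlgebraicComplexity

section AnyField

variable (K : Type) [Field K]

/-- **Lotti–Romani 1983, §2: `f(x + d) ≤ f(x) + d` (`d ≥ 0`)** for `f(x) = B(1, x, 1)` — every field, every
real `x`. [cite: LottiRomani1983, §2 (p. 174)] -/
theorem omegaRect_one_mid_one_add_le (x : ℝ) {d : ℝ} (hd : 0 ≤ d) :
    omegaRect K 1 (x + d) 1 ≤ omegaRect K 1 x 1 + d := by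
  have h := omegaRect_add_le_add_pos K 1 x 1 0 d 0
  simp only [add_zero, max_eq_left hd, le_refl, max_eq_right, zero_add] at h
  exact h

/-- Hence **`x ↦ ω(1, x, 1) − x` is non-increasing** (Lotti–Romani §2: `f(x+d) − (x+d) ≤ f(x) − x`).
[cite: LottiRomani1983, §2 (p. 174)] -/
theorem omegaRect_one_mid_one_sub_antitone : Antitone fun x : ℝ => omegaRect K 1 x 1 - x := by
  intro x y hxy
  have h := omegaRect_one_mid_one_add_le K x (sub_nonneg.2 hxy)
  rw [add_sub_cancel] at h
  show omegaRect K 1 y 1 - y ≤ omegaRect K 1 x 1 - x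
  linarith

/-- **Lotti–Romani 1983, §2: `f(x) ≥ x + 1`**, i.e. `1 ≤ ω(1, x, 1) − x` (the tree's information bound
`max_two_add_one_le_omegaRect_one_mid_one`). [cite: LottiRomani1983, §2 (p. 174)] -/
theorem one_le_omegaRect_one_mid_one_sub (x : ℝ) : 1 ≤ omegaRect K 1 x 1 - x := by
  have h := (le_max_right 2 (x + 1)).trans (max_two_add_one_le_omegaRect_one_mid_one K x)
  linarith

end AnyField

/-- **Lotti–Romani 1983, Proposition 4.1 (stated by Coppersmith 1982): `inf_{x→∞} [f(x) − x] = 1`**, where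
`f(x) = B(x,1,1) = B(1,x,1) = B(1,1,x)` is the exponent of `N × ⌈N^x⌉` by `⌈N^x⌉ × N` matrix
multiplication over `ℂ` — rendered with the tree's rank-form rectangular exponent in the middle placement,
`f(x) = omegaRect ℂ 1 x 1`, and Mathlib's `Filter.liminf` at `+∞` for `inf_{x→∞}`. A named fact: the
printed proof (Example 3.2 = Schönhage's decomposition through the paper's Prop. 3.3) is not formalized
here. Coppersmith states it as «for each `β > 0` there is an `α > 1` such that
`Rank(⟨N, N, N^α⟩) = O(N^{α+1+β} (log N)^{3/2})`» (p. 471), which with §2's monotonicity is the same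
assertion. [cite: LottiRomani1983, Prop. 4.1 (pp. 180–181)] [cite: Coppersmith1982, p. 471 (closing remarks)] -/
def LottiRomani1983_prop41 : Prop :=
  Filter.liminf (fun x : ℝ => omegaRect ℂ 1 x 1 - x) atTop = 1

/-- The set whose supremum is the `liminf` (`Filter.liminf_eq`) contains exactly… at least every `a ≤ 1`,
because `f(x) − x ≥ 1` everywhere. [cite: LottiRomani1983, §2 (p. 174)] -/
theorem mem_setOf_eventually_le_omegaRect_sub {a : ℝ} (ha : a ≤ 1) :
    a ∈ {a : ℝ | ∀ᶠ x in atTop, a ≤ omegaRect ℂ 1 x 1 - x} :=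
  Eventually.of_forall fun x => ha.trans (one_le_omegaRect_one_mid_one_sub ℂ x)

/-- **Prop. 4.1 ⇒ for every `ε > 0` there are arbitrarily large `x` with `ω_ℂ(1,x,1) ≤ x + 1 + ε`.**
[cite: LottiRomani1983, Prop. 4.1 (pp. 180–181)] -/
theorem LottiRomani1983_prop41.frequently_le (h : LottiRomani1983_prop41) {ε : ℝ} (hε : 0 < ε) :
    ∃ᶠ x in atTop, omegaRect ℂ 1 x 1 ≤ x + 1 + ε := by
  unfold LottiRomani1983_prop41 at h
  rw [Filter.liminf_eq] at h
  set S : Set ℝ := {a : ℝ | ∀ᶠ x in atTop, a ≤ omegaRect ℂ 1 x 1 - x} with hS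
  have hbdd : BddAbove S := by
    by_contra hnb
    rw [Real.sSup_of_not_bddAbove hnb] at h
    exact zero_ne_one h
  have hnot : (1 + ε) ∉ S := by
    intro hmem
    have := le_csSup hbdd hmem
    linarith
  simp only [hS, Set.mem_setOf_eq, Filter.not_eventually, not_le] at hnot
  exact hnot.mono fun x hx => by linarith

/-- **Prop. 4.1 in the eventual form (with §2's monotonicity): for every `ε > 0` there is `k₀` with
`ω_ℂ(1, k, 1) ≤ k + 1 + ε` for all `k ≥ k₀`** — «`f(x)` is arbitrarily close to the lower bound `x + 1`
for sufficiently large `x`» (p. 180). [cite: LottiRomani1983, Prop. 4.1 (pp. 180–181); §2 (p. 174)] -/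
theorem LottiRomani1983_prop41.eventually_le (h : LottiRomani1983_prop41) {ε : ℝ} (hε : 0 < ε) :
    ∃ k₀ : ℝ, ∀ k ≥ k₀, omegaRect ℂ 1 k 1 ≤ k + 1 + ε := by
  obtain ⟨k₀, hk₀⟩ := (h.frequently_le hε).exists
  refine ⟨k₀, fun k hk => ?_⟩
  have hmono := omegaRect_one_mid_one_sub_antitone ℂ hk
  simp only at hmono
  linarith

/-- The same as an `atTop`-eventuality. [cite: LottiRomani1983, Prop. 4.1 (pp. 180–181)] -/
theorem LottiRomani1983_prop41.eventually_le' (h : LottiRomani1983_prop41) {ε : ℝ} (hε : 0 < ε) :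
    ∀ᶠ k in atTop, omegaRect ℂ 1 k 1 ≤ k + 1 + ε := by
  obtain ⟨k₀, hk₀⟩ := h.eventually_le hε
  exact eventually_atTop.2 ⟨k₀, hk₀⟩

/-- **Prop. 4.1 with §2 ⇒ `ω_ℂ(1, x, 1) − x → 1` as `x → ∞`** (squeezed between `1` and `1 + ε`).
[cite: LottiRomani1983, Prop. 4.1 (pp. 180–181); §2 (p. 174)] -/
theorem LottiRomani1983_prop41.tendsto (h : LottiRomani1983_prop41) :
    Tendsto (fun x : ℝ => omegaRect ℂ 1 x 1 - x) atTop (𝓝 1) := by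
  rw [Metric.tendsto_atTop]
  intro ε hε
  obtain ⟨k₀, hk₀⟩ := h.eventually_le (half_pos hε)
  refine ⟨k₀, fun x hx => ?_⟩
  have h₁ := one_le_omegaRect_one_mid_one_sub ℂ x
  have h₂ := hk₀ x hx
  rw [Real.dist_eq, abs_lt]
  constructor <;> linarith

/-- Conversely the eventual bound gives back the printed `inf_{x→∞} [f(x) − x] = 1` (with §2's
`f(x) ≥ x + 1`): **the named fact is EQUIVALENT to
`∀ ε > 0, ∃ k₀, ∀ k ≥ k₀, ω_ℂ(1,k,1) ≤ k + 1 + ε`.**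
[cite: LottiRomani1983, Prop. 4.1 (pp. 180–181); §2 (p. 174)] -/
theorem LottiRomani1983_prop41_iff_eventually_le :
    LottiRomani1983_prop41 ↔ ∀ ε > 0, ∃ k₀ : ℝ, ∀ k ≥ k₀, omegaRect ℂ 1 k 1 ≤ k + 1 + ε := by
  refine ⟨fun h ε hε => h.eventually_le hε, fun h => ?_⟩
  unfold LottiRomani1983_prop41
  rw [Filter.liminf_eq]
  set S : Set ℝ := {a : ℝ | ∀ᶠ x in atTop, a ≤ omegaRect ℂ 1 x 1 - x} with hS
  have h1 : (1 : ℝ) ∈ S := mem_setOf_eventually_le_omegaRect_sub le_rfl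
  have hle : ∀ a ∈ S, a ≤ 1 := by
    intro a ha
    by_contra hlt
    push Not at hlt
    obtain ⟨k₀, hk₀⟩ := h ((a - 1) / 2) (by linarith)
    have hev : ∀ᶠ x in atTop, omegaRect ℂ 1 x 1 ≤ x + 1 + (a - 1) / 2 := eventually_atTop.2 ⟨k₀, hk₀⟩
    obtain ⟨x, hx₁, hx₂⟩ := (ha.and hev).exists
    linarith
  exact le_antisymm (csSup_le ⟨1, h1⟩ hle) (le_csSup ⟨1, hle⟩ h1)

end Literature.Computability.AlgebraicComplexity

end
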